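import Summits.BirchSwinnertonDyer.Rank1Residual.Additive.GordRankOneIwasawa
import Summits.BirchSwinnertonDyer.Rank1Residual.Additive.GordNonAnomalousFour
import HarnessLib

/-!
# The (G)-cell at analytic rank ONE, II: the Kato-shaped upper divisibility at order one, and the
# class forms on X4♯(G-ord) ∩ {r = 1} and X3♯(G-ord) ∩ {r = 1}
# (cell `b2b-bsdres`, sub-cell additive-p2, gen 18; sequel of `GordRankOneIwasawa.lean`)

HONEST FRAMING (cell `b2b-bsdres`, run/shared/lean/b2b/bsd-rank1-residual/, verbatim in every
file): the goal of the cell is to DELETE the COMBINATION-SHAPED residual classes of the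
Birch–Swinnerton-Dyer formula for ALL analytic-rank `≤ 1` elliptic curves over `ℚ` — "full BSD
formula for every rank `≤ 1` curve in class `C`" assembled STRICTLY from published theorems — so
that the rank-`≤ 1` remainder becomes exactly the CONSTRUCTION-SHAPED classes, which are TYPED
(missing-input `Prop`s), NOT attempted. This is not "finishing BSD". Sub-cell `additive-p2`, gen 18:
research route; no claim beyond the stated classes; X3♯(G-ord)/X4♯(G-ord) stay CONSTRUCTION-SHAPED;
labels / census / located gap UNCHANGED; nothing is booked. Theorems only (no `def`, no new fact).

Contents (the whole story is in the module docstring of `GordRankOneIwasawa.lean`):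
* the UPPER divisibility at order one (`CycLeadingTermOneAt W p Dh`, Kato-shaped: SOME `g ∈ char X`
  with `g(0) = 0` and `[T¹] g · log_p(γ_cyc) = u · q · Reg_p`) for a height datum with Delbourgo's
  clauses and `Reg_p ≠ 0` ⟹ `Typed.MissingUpperBoundAt` on every row of the (G)-cell at rank one
  (`g = f · h`, `f(0) = 0`, `[T¹] g = [T¹] f · h(0)`, the regulators cancel);
* class forms: X4♯(G-ord) ∩ {`r_an = 1`} and — the FIRST class-level statements there —
  X3♯(G-ord) ∩ {`r_an = 1`}, every defect, `p ≥ 5`, `E` non-CM: the residue `RankOneIwasawaInputAt`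
  ⟹ the upper half on every row, `ord_p #Ш ≤ ord_p #Ш_an ≤ ord_p #Ш + 2`, `BSD(E,p)` off the anomalous
  rows, and "what remains is EXACTLY the lower half";
* §4 DEFECT 4 (Kodaira III/III*, `p ≥ 7`, hence `p ≡ 1 (mod 4)`, `p ≥ 13` on the (G)-cell): the
  non-anomalous hypothesis is a THEOREM (gen 11, `GordNonAnomalousFour`: `j̃ = 1728` gives a rational
  `2`-torsion point on the reduction, and Hasse's interval holds no even multiple of `p ≥ 7`), so the
  rank-`0` and rank-`1` statements are EXACT there: `BSD(E,p)` ⇐ MC equality at `T = 0` (rank `0`) /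
  the Iwasawa-route residue (rank `1`), with NO anomalous proviso.

References: D. Delbourgo, J. Number Theory 95 (2002) Theorem (A), (B) [Delbourgo2002]; K. Kato,
Astérisque 295 (2004) Thm. 17.4 [Kato2004Asterisque]; R. L. Miller, LMS J. Comput. Math. 14 (2011)
Def. 1.1 [Miller2011LMS].
-/

noncomputable section

open scoped Classical NumberField

open WeierstrassCurve NumberField Literature.NumberTheory.EllipticCurves
  Literature.NumberTheory.EllipticCurves.ModularForms
  Literature.NumberTheory.EllipticCurves.Rank1Residual
  Literature.NumberTheory.EllipticCurves.Rank1Residual.Typed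
  IsDedekindDomain

namespace Summit.BirchSwinnertonDyer.Rank1Residual.Additive

variable (W : WeierstrassCurve ℚ) (p : ℕ) [hp : Fact p.Prime] [W.IsElliptic] [W.IsGloballyMinimal]

/-- **Rank ONE, (G)-cell: the UPPER divisibility (Kato-shaped: SOME `g ∈ char X` with the analytic
leading term) for a datum with Delbourgo's clauses and `Reg_p ≠ 0` ⟹ the UPPER half on every row.**
(`g = f · h`, `f(0) = 0` by clause 1, so `[T¹] g = [T¹] f · h(0)`.) [cite: Delbourgo2002, Theorem (B) (p. 40)] -/
theorem missingUpperBoundAt_rankOne_of_cycLeadingTermOne (hDel : Delbourgo2002.mainTheorem)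
    (hGZK : rank_eq_analyticRank_of_analyticRank_le_one) (hmod : hasEntireLFunction_rat)
    (hp5 : 5 ≤ p) (hcm : ¬ W.HasCM) (hadd : Addv W p) (hG : TypeGOrd W p)
    (hr : W.analyticRank = 1) {Dh : PAdicHeightData W p}
    (hB : Delbourgo2002.LeadingTermClauses W p Dh) (hS : SchneiderConjecture Dh)
    (hUp : CycLeadingTermOneAt W p Dh) : MissingUpperBoundAt W p := by
  classical
  obtain ⟨κ, γ, hκ, hγ, hγ', D, f, hf⟩ := exists_cyclotomic_dualData_generator W p
  have hadd' : ¬ W.HasGoodReductionAtPrime p ∧ ¬ W.HasMultiplicativeReductionAtPrime p := hadd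
  have hX : D.IsTorsion := Delbourgo2002.mainTheorem.isTorsion hDel hp5 hcm hadd' hG hκ hγ D
  haveI : Module.Finite (IwasawaAlgebra p) D.X :=
    SelmerDualData.module_finite_of_isCyclotomic (W := W) (κ := κ) hκ D hγ
  obtain ⟨g, hg, u, q, hLq, hg0, hg1⟩ := hUp κ γ hκ hγ hγ' D
  -- `g = f · h`
  have hgmem : g ∈ Ideal.span {f} := by rw [← hf]; exact hg
  obtain ⟨h, hgh⟩ := Ideal.mem_span_singleton'.mp hgmem
  -- `f(0) = 0`: clause 1 at rank 1
  obtain ⟨hmw, -⟩ := hGZK W (by rw [hr])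
  have hmw1 : W.mordellWeilRank = 1 := by rw [hmw, hr]
  have hle : (W.mordellWeilRank : ℕ∞) ≤ f.order := (hB κ γ hκ hγ hγ' D hX f hf).1
  have hf0 : PowerSeries.constantCoeff f = 0 := by
    rw [← PowerSeries.coeff_zero_eq_constantCoeff]
    apply PowerSeries.coeff_of_lt_order
    refine lt_of_lt_of_le ?_ hle
    rw [hmw1]
    exact_mod_cast Nat.zero_lt_one
  -- `[T¹] g = [T¹] f · h(0)`
  have hg1' : PowerSeries.coeff 1 g = PowerSeries.coeff 1 f * PowerSeries.constantCoeff h := by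
    rw [← hgh, mul_comm h f, PowerSeries.coeff_mul, Finset.Nat.antidiagonal_succ, Finset.sum_cons,
      Finset.Nat.antidiagonal_zero]
    simp [hf0]
  have hc1 : ((PowerSeries.coeff 1 f : ℤ_[p]) : ℚ_[p]) * padicLog p (cyclotomicGenerator p) *
      ((PowerSeries.constantCoeff h : ℤ_[p]) : ℚ_[p]) =
      ((u : ℤ_[p]) : ℚ_[p]) * (q : ℚ_[p]) * padicRegulator Dh := by
    rw [← hg1, hg1']
    push_cast
    ring
  -- rank 1: `L'(E,1) ≠ 0`, `rank = 1`, `Ш` finite; (B) at `r = 1` for `Dh`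
  have hmw1 : W.mordellWeilRank = 1 := by rw [hmw, hr]
  obtain ⟨-, hfin⟩ := hGZK W (by rw [hr])
  haveI : Finite W.sha := hfin
  have hfinp : Finite (AddCommGroup.primaryComponent W.sha p) :=
    Finite.of_injective _ Subtype.val_injective
  have hLne : W.leadingLCoeff ≠ 0 := W.leadingLCoeff_ne_zero_holds (hmod W)
  have hq0 : q ≠ 0 := by
    rintro rfl
    rw [Rat.cast_zero, zero_mul, zero_mul] at hLq
    exact hLne hLq
  obtain ⟨u', ℓ, hℓp, -, heq⟩ := hB.leadingCoeff hκ hγ hγ' D hX hf hS hfinp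
  rw [hmw1, pow_one] at heq
  -- `u q Reg tors² = u' ℓ h(0) Ш(p) Reg Tam`; cancel `Reg ≠ 0`
  set d : ℤ_[p] := PowerSeries.constantCoeff h with hd
  have hReg : padicRegulator Dh ≠ 0 := hS
  have hkey : (((u : ℤ_[p]) : ℤ_[p]) : ℚ_[p]) * (q : ℚ_[p]) * ((W.torsionOrder : ℕ) : ℚ_[p]) ^ 2 =
      ((u' : ℤ_[p]) : ℚ_[p]) * (ℓ : ℚ_[p]) * (d : ℚ_[p]) *
        ((Nat.card (AddCommGroup.primaryComponent W.sha p) : ℚ_[p]) * (W.tamagawaProduct : ℚ_[p])) := by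
    have h2 : ((((u : ℤ_[p]) : ℤ_[p]) : ℚ_[p]) * (q : ℚ_[p]) * ((W.torsionOrder : ℕ) : ℚ_[p]) ^ 2) *
        padicRegulator Dh =
        (((u' : ℤ_[p]) : ℚ_[p]) * (ℓ : ℚ_[p]) * (d : ℚ_[p]) *
          ((Nat.card (AddCommGroup.primaryComponent W.sha p) : ℚ_[p]) * (W.tamagawaProduct : ℚ_[p]))) *
          padicRegulator Dh := by
      calc ((((u : ℤ_[p]) : ℤ_[p]) : ℚ_[p]) * (q : ℚ_[p]) * ((W.torsionOrder : ℕ) : ℚ_[p]) ^ 2) *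
            padicRegulator Dh
          = (((u : ℤ_[p]) : ℚ_[p]) * (q : ℚ_[p]) * padicRegulator Dh) *
              ((W.torsionOrder : ℕ) : ℚ_[p]) ^ 2 := by ring
        _ = (((PowerSeries.coeff 1 f : ℤ_[p]) : ℚ_[p]) * padicLog p (cyclotomicGenerator p) *
              (W.torsionOrder : ℚ_[p]) ^ 2) * (d : ℚ_[p]) := by rw [← hc1, hd]; ring
        _ = (((u' : ℤ_[p]) : ℚ_[p]) * (ℓ : ℚ_[p]) *
              ((Nat.card (AddCommGroup.primaryComponent W.sha p) : ℚ_[p]) *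
                padicRegulator Dh * W.tamagawaProduct)) * (d : ℚ_[p]) := by rw [heq]
        _ = _ := by ring
    exact mul_right_cancel₀ hReg h2
  have hd0 : d ≠ 0 := by
    intro h0
    have : (((u : ℤ_[p]) : ℤ_[p]) : ℚ_[p]) * (q : ℚ_[p]) * ((W.torsionOrder : ℕ) : ℚ_[p]) ^ 2 = 0 := by
      rw [hkey, h0]; simp
    have hT : ((W.torsionOrder : ℕ) : ℚ_[p]) ≠ 0 := by exact_mod_cast W.torsionOrder_pos_holds.ne'
    have hqQ : ((q : ℚ) : ℚ_[p]) ≠ 0 := by exact_mod_cast hq0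
    exact mul_ne_zero (mul_ne_zero (coe_units_ne_zero p u) hqQ) (pow_ne_zero 2 hT) this
  have hT0 : W.torsionOrder ≠ 0 := W.torsionOrder_pos_holds.ne'
  have hTam : 0 < W.tamagawaProduct := W.tamagawaProduct_pos_holds
  have hS0 : Nat.card (AddCommGroup.primaryComponent W.sha p) ≠ 0 := Nat.card_pos.ne'
  have hℓ0 : ℓ ≠ 0 := by
    rintro rfl
    exact pow_ne_zero 2 hp.out.ne_zero (Nat.eq_zero_of_zero_dvd hℓp)
  have hsha : padicValNat p (Nat.card (AddCommGroup.primaryComponent W.sha p)) =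
      padicValNat p W.shaOrder := by
    unfold WeierstrassCurve.shaOrder
    exact padicValNat_card_addPrimaryComponent p
  obtain ⟨-, hval⟩ :=
    padicVal_bookkeeping_cofactor (p := p) (c := (u : ℤ_[p])) u' hq0 hT0 hS0 hTam.ne' hℓ0 hd0 hkey
  rw [hsha, valuation_coe_units_eq_zero, add_zero] at hval
  refine ⟨q * (W.torsionOrder : ℚ) ^ 2 / (W.tamagawaProduct : ℚ),
    shaAn_eq_of_leadingLCoeff_eq W hLq, ?_⟩
  have hℓ : (0 : ℤ) ≤ padicValNat p ℓ := by exact_mod_cast Nat.zero_le _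
  have hdv : 0 ≤ ((d : ℤ_[p]) : ℚ_[p]).valuation := PadicInt.valuation_coe_nonneg
  linarith

variable {W p}

/-! ### §3 Class forms at rank one: X4♯(G-ord) and — NEW — X3♯(G-ord), every defect, `p ≥ 5` -/

/-- **X4♯(G-ord) ∩ {r_an = 1}, ANY defect, `p ≥ 5`, `E` non-CM: the Iwasawa-route residue
`RankOneIwasawaInputAt W p` ⟹ the UPPER half on every row and `BSD(E,p)` off the anomalous rows.**
NO image, Tamagawa or Manin hypothesis (compare the Kolyvagin route of additive-p1 / gens 14–17, which
needs `ρ̄` onto and the lower halves of rank-`0` twists). X4♯(G-ord) stays CONSTRUCTION-SHAPED.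
[cite: Delbourgo2002, Theorem (A), (B) (p. 40)] -/
theorem ClassX4Gord.bsdp_rankOne_of_iwasawaInput_of_nonAnomalous (hDel : Delbourgo2002.mainTheorem)
    (hGZK : rank_eq_analyticRank_of_analyticRank_le_one) (hmod : hasEntireLFunction_rat)
    (hX : ClassX4Gord W p) (hcm : ¬ W.HasCM) (hp5 : 5 ≤ p) (hr : W.analyticRank = 1)
    (hIn : RankOneIwasawaInputAt W p) (hna : Delbourgo2002.ReductionNonAnomalous W p) : BSDp W p :=
  bsdp_rankOne_of_input_of_nonAnomalous W p hDel hGZK hmod hp5 hcm hX.addv.2 hX.typeGOrd hr hIn hna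

/-- **X4♯(G-ord) ∩ {r_an = 1}, ANY defect, `p ≥ 5`, `E` non-CM: the UPPER half
`ord_p #Ш(E) ≤ ord_p #Ш_an(E)` from the Iwasawa-route residue, every row.**
[cite: Delbourgo2002, Theorem (A), (B) (p. 40)] -/
theorem ClassX4Gord.missingUpperBoundAt_rankOne_of_iwasawaInput (hDel : Delbourgo2002.mainTheorem)
    (hGZK : rank_eq_analyticRank_of_analyticRank_le_one) (hmod : hasEntireLFunction_rat)
    (hX : ClassX4Gord W p) (hcm : ¬ W.HasCM) (hp5 : 5 ≤ p) (hr : W.analyticRank = 1)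
    (hIn : RankOneIwasawaInputAt W p) : MissingUpperBoundAt W p :=
  missingUpperBoundAt_rankOne_of_input W p hDel hGZK hmod hp5 hcm hX.addv.2 hX.typeGOrd hr hIn

/-- **X4♯(G-ord) ∩ {r_an = 1}: what remains, granted the Iwasawa-route residue, is EXACTLY the lower
half over `ℚ`** (`X4.MissingInputAt W p ↔ MissingLowerBoundAt W p`). [cite: Delbourgo2002, Theorem (B) (p. 40)] -/
theorem ClassX4Gord.missingInputAt_iff_lower_rankOne_of_iwasawaInput (hDel : Delbourgo2002.mainTheorem)
    (hGZK : rank_eq_analyticRank_of_analyticRank_le_one) (hmod : hasEntireLFunction_rat)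
    (hX : ClassX4Gord W p) (hcm : ¬ W.HasCM) (hp5 : 5 ≤ p) (hr : W.analyticRank = 1)
    (hIn : RankOneIwasawaInputAt W p) : X4.MissingInputAt W p ↔ MissingLowerBoundAt W p :=
  ⟨fun h ↦ (lower_and_upper_of_missingPPartAt W p h).1, fun h ↦
    missingPPartAt_of_lower_of_upper W p h
      (ClassX4Gord.missingUpperBoundAt_rankOne_of_iwasawaInput hDel hGZK hmod hX hcm hp5 hr hIn)⟩

/-- **X3♯(G-ord) ∩ {r_an = 1}, ANY defect, `p ≥ 5`, `E` non-CM — the FIRST class-level statement on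
this cell: the Iwasawa-route residue `RankOneIwasawaInputAt W p` ⟹ `BSD(E,p)` off the anomalous
rows.** (Reducible `E[p]`: no Kolyvagin route; Keller–Yin's additive `p`-converse is a PREPRINT.)
X3♯(G-ord) stays CONSTRUCTION-SHAPED. [cite: Delbourgo2002, Theorem (A), (B) (p. 40)] -/
theorem ClassX3Gord.bsdp_rankOne_of_iwasawaInput_of_nonAnomalous (hDel : Delbourgo2002.mainTheorem)
    (hGZK : rank_eq_analyticRank_of_analyticRank_le_one) (hmod : hasEntireLFunction_rat)
    (hX : ClassX3Gord W p) (hcm : ¬ W.HasCM) (hp5 : 5 ≤ p) (hr : W.analyticRank = 1)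
    (hIn : RankOneIwasawaInputAt W p) (hna : Delbourgo2002.ReductionNonAnomalous W p) : BSDp W p :=
  bsdp_rankOne_of_input_of_nonAnomalous W p hDel hGZK hmod hp5 hcm hX.addv hX.typeGOrd hr hIn hna

/-- **X3♯(G-ord) ∩ {r_an = 1}, ANY defect, `p ≥ 5`, `E` non-CM: the UPPER half
`ord_p #Ш(E) ≤ ord_p #Ш_an(E)` from the Iwasawa-route residue, every row** — the first upper bound on
`Ш[p^∞]` typed for this cell at rank one. [cite: Delbourgo2002, Theorem (A), (B) (p. 40)] -/
theorem ClassX3Gord.missingUpperBoundAt_rankOne_of_iwasawaInput (hDel : Delbourgo2002.mainTheorem)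
    (hGZK : rank_eq_analyticRank_of_analyticRank_le_one) (hmod : hasEntireLFunction_rat)
    (hX : ClassX3Gord W p) (hcm : ¬ W.HasCM) (hp5 : 5 ≤ p) (hr : W.analyticRank = 1)
    (hIn : RankOneIwasawaInputAt W p) : MissingUpperBoundAt W p :=
  missingUpperBoundAt_rankOne_of_input W p hDel hGZK hmod hp5 hcm hX.addv hX.typeGOrd hr hIn

/-- **X3♯(G-ord) ∩ {r_an = 1}: `ord_p #Ш(E) ≤ ord_p #Ш_an(E) ≤ ord_p #Ш(E) + 2` on every row from the
Iwasawa-route residue.** [cite: Delbourgo2002, Theorem (A), (B) (p. 40)] -/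
theorem ClassX3Gord.padicVal_shaAn_bounds_rankOne_of_iwasawaInput (hDel : Delbourgo2002.mainTheorem)
    (hGZK : rank_eq_analyticRank_of_analyticRank_le_one) (hmod : hasEntireLFunction_rat)
    (hX : ClassX3Gord W p) (hcm : ¬ W.HasCM) (hp5 : 5 ≤ p) (hr : W.analyticRank = 1)
    (hIn : RankOneIwasawaInputAt W p) :
    ∃ q : ℚ, shaAn W = (q : ℂ) ∧ (padicValNat p W.shaOrder : ℤ) ≤ padicValRat p q ∧
      padicValRat p q ≤ (padicValNat p W.shaOrder : ℤ) + 2 :=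
  padicVal_shaAn_bounds_rankOne_of_input W p hDel hGZK hmod hp5 hcm hX.addv hX.typeGOrd hr hIn

/-- **X3♯(G-ord) ∩ {r_an = 1}: what remains, granted the Iwasawa-route residue, is EXACTLY the lower
half over `ℚ`** (`Gord.MissingInputAt W p ↔ MissingLowerBoundAt W p`). [cite: Delbourgo2002, Theorem (B) (p. 40)] -/
theorem ClassX3Gord.missingInputAt_iff_lower_rankOne_of_iwasawaInput (hDel : Delbourgo2002.mainTheorem)
    (hGZK : rank_eq_analyticRank_of_analyticRank_le_one) (hmod : hasEntireLFunction_rat)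
    (hX : ClassX3Gord W p) (hcm : ¬ W.HasCM) (hp5 : 5 ≤ p) (hr : W.analyticRank = 1)
    (hIn : RankOneIwasawaInputAt W p) : Gord.MissingInputAt W p ↔ MissingLowerBoundAt W p :=
  ⟨fun h ↦ (lower_and_upper_of_missingPPartAt W p h).1, fun h ↦
    missingPPartAt_of_lower_of_upper W p h
      (ClassX3Gord.missingUpperBoundAt_rankOne_of_iwasawaInput hDel hGZK hmod hX hcm hp5 hr hIn)⟩

/-! ### §4 Defect `4` (Kodaira III / III*): the anomalous proviso is a theorem -/

variable (W p) in
/-- **On the defect-`4` rows at `p ≥ 7` the reduction over every (G)-field is NON-anomalous**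
(`Delbourgo2002.ReductionNonAnomalous W p`): gen 11's
`not_dvd_natCard_point_reductionAt_intermediateField_of_semistabilityIndex_eq_four` (`j̃ = 1728`,
rational `2`-torsion on the reduction, Hasse) is literally the predicate. [cite: Delbourgo2002, p. 39 (ℓ_p(E) = 1 when Ĩ(𝔽_p) has no p-torsion)] -/
theorem reductionNonAnomalous_of_semistabilityIndex_eq_four (hp7 : 7 ≤ p)
    (he : semistabilityIndex W p = 4) : Delbourgo2002.ReductionNonAnomalous W p :=
  fun _ _ _ _ F w hw hgood ↦
    not_dvd_natCard_point_reductionAt_intermediateField_of_semistabilityIndex_eq_four W p hp7 he F w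
      hw hgood

/-- **X4♯(G-ord) ∩ {III, III*} (defect `4`), `p ≥ 7`, `r_an = 0`, `E` non-CM: MC EQUALITY at `T = 0`
⟹ `BSD(E,p)`** — exact, no anomalous proviso, no image / Tamagawa / Manin / `#Ш_an` hypothesis.
[cite: Delbourgo2002, Theorem (A), (B) (p. 40)] -/
theorem ClassX4Gord.bsdp_rankZero_of_cycChar_of_semistabilityIndex_eq_four
    (hDel : Delbourgo2002.mainTheorem)
    (hGZK : rank_eq_analyticRank_of_analyticRank_le_one) (hmod : hasEntireLFunction_rat)
    (hX : ClassX4Gord W p) (hcm : ¬ W.HasCM) (hp7 : 7 ≤ p) (he : semistabilityIndex W p = 4)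
    (hr : W.analyticRank = 0) (hMC : CycCharLeadingTermAt W p) : BSDp W p :=
  ClassX4Gord.bsdp_rankZero_of_cycChar_of_nonAnomalous hDel hGZK hmod hX hcm (by omega) hr hMC
    (reductionNonAnomalous_of_semistabilityIndex_eq_four W p hp7 he)

/-- **X4♯(G-ord) ∩ {III, III*}, `p ≥ 7`, `r_an = 0`, `E` non-CM: the LOWER half ⇐ the LOWER
divisibility of the MC at `T = 0`** — exact. [cite: Delbourgo2002, Theorem (B) (p. 40)] -/
theorem ClassX4Gord.missingLowerBoundAt_rankZero_of_cycLower_of_semistabilityIndex_eq_four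
    (hDel : Delbourgo2002.mainTheorem)
    (hGZK : rank_eq_analyticRank_of_analyticRank_le_one) (hmod : hasEntireLFunction_rat)
    (hX : ClassX4Gord W p) (hcm : ¬ W.HasCM) (hp7 : 7 ≤ p) (he : semistabilityIndex W p = 4)
    (hr : W.analyticRank = 0) (hLow : CycLowerLeadingTermAt W p) : MissingLowerBoundAt W p :=
  ClassX4Gord.missingLowerBoundAt_rankZero_of_cycLower_of_nonAnomalous hDel hGZK hmod hX hcm (by omega)
    hr hLow (reductionNonAnomalous_of_semistabilityIndex_eq_four W p hp7 he)

/-- **X4♯(G-ord) ∩ {III, III*}, `p ≥ 7`, `r_an = 1`, `E` non-CM: the Iwasawa-route residue ⟹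
`BSD(E,p)`** — exact. [cite: Delbourgo2002, Theorem (A), (B) (p. 40)] -/
theorem ClassX4Gord.bsdp_rankOne_of_iwasawaInput_of_semistabilityIndex_eq_four
    (hDel : Delbourgo2002.mainTheorem)
    (hGZK : rank_eq_analyticRank_of_analyticRank_le_one) (hmod : hasEntireLFunction_rat)
    (hX : ClassX4Gord W p) (hcm : ¬ W.HasCM) (hp7 : 7 ≤ p) (he : semistabilityIndex W p = 4)
    (hr : W.analyticRank = 1) (hIn : RankOneIwasawaInputAt W p) : BSDp W p :=
  ClassX4Gord.bsdp_rankOne_of_iwasawaInput_of_nonAnomalous hDel hGZK hmod hX hcm (by omega) hr hIn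
    (reductionNonAnomalous_of_semistabilityIndex_eq_four W p hp7 he)

/-- **X3♯(G-ord) ∩ {III, III*}, `p ≥ 7`, `r_an = 0`, `E` non-CM: MC EQUALITY at `T = 0` ⟹ `BSD(E,p)`**
— exact. [cite: Delbourgo2002, Theorem (A), (B) (p. 40)] -/
theorem ClassX3Gord.bsdp_rankZero_of_cycChar_of_semistabilityIndex_eq_four
    (hDel : Delbourgo2002.mainTheorem)
    (hGZK : rank_eq_analyticRank_of_analyticRank_le_one) (hmod : hasEntireLFunction_rat)
    (hX : ClassX3Gord W p) (hcm : ¬ W.HasCM) (hp7 : 7 ≤ p) (he : semistabilityIndex W p = 4)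
    (hr : W.analyticRank = 0) (hMC : CycCharLeadingTermAt W p) : BSDp W p :=
  ClassX3Gord.bsdp_rankZero_of_cycChar_of_nonAnomalous hDel hGZK hmod hX hcm (by omega) hr hMC
    (reductionNonAnomalous_of_semistabilityIndex_eq_four W p hp7 he)

/-- **X3♯(G-ord) ∩ {III, III*}, `p ≥ 7`, `r_an = 1`, `E` non-CM: the Iwasawa-route residue ⟹
`BSD(E,p)`** — exact. [cite: Delbourgo2002, Theorem (A), (B) (p. 40)] -/
theorem ClassX3Gord.bsdp_rankOne_of_iwasawaInput_of_semistabilityIndex_eq_four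
    (hDel : Delbourgo2002.mainTheorem)
    (hGZK : rank_eq_analyticRank_of_analyticRank_le_one) (hmod : hasEntireLFunction_rat)
    (hX : ClassX3Gord W p) (hcm : ¬ W.HasCM) (hp7 : 7 ≤ p) (he : semistabilityIndex W p = 4)
    (hr : W.analyticRank = 1) (hIn : RankOneIwasawaInputAt W p) : BSDp W p :=
  ClassX3Gord.bsdp_rankOne_of_iwasawaInput_of_nonAnomalous hDel hGZK hmod hX hcm (by omega) hr hIn
    (reductionNonAnomalous_of_semistabilityIndex_eq_four W p hp7 he)

end Summit.BirchSwinnertonDyer.Rank1Residual.Additive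

end
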